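import Literature.MathematicalPhysics.QuantumFieldTheory.BalabanImbrieJaffe1984to88.BIJ88BasicForms331OpsTorus
import Literature.MathematicalPhysics.QuantumFieldTheory.BalabanImbrieJaffe1984to88.BIJ88IdentityB1p296Proof

/-!
# `BalabanImbrieJaffe1984to88.BIJ88ScalarSummary583OpsTorus` — T. Bałaban, J. Imbrie, A. Jaffe, *Effective action and cluster properties of the
abelian Higgs model*, Commun. Math. Phys. **114** (1988) 257–315 [BalabanImbrieJaffe1988], Sect. 5.8 pp. 295–296 [PDF 39–40]: **THE SCALAR
TRANSLATION (5.8.1)–(5.8.3) AT A GENERAL STEP `k` AT THE OBJECTS OF RECORD ON THE TORUS** — [7]'s one-step renormalization data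
`Balaban1983to89.B1RG242.StepData` INSTANTIATED at the U(1)-covariant torus operators of level `k` with EVERY hypothesis of `B1RG242` discharged,
hence the identity of [7] quoted on p. 296 (and [7] (2.41)/(2.42)) as complex-matrix identities for these operators; p02's §5.8 operator dictionary
`BIJ88ScalarSummary583.Ops` INSTANTIATED at step `k` on the realified carriers with its Euclidean laws `Ops.Laws` PROVED; hence p02's abstract
(5.8.3) `Ops.eq583` read on the kernels of record (the general-`k` twin of p29 gen 35's step-0 file `BIJ88BasicForms331OpsTorus`)

statement-level skeleton of published theorems with citation tags; proofs where landed; nothing here is a claim about the Yang–Mills mass gap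

PDF held: `paper:balaban1988-cmp114-bij-abelian-higgs-effective-action` (journal page = PDF page + 256); pp. 295–296 [PDF 39–40] re-read this session
(`lit read`, text layer `p0039.txt`/`p0040.txt`; the displays are garbled there and are taken from the row owner's / p02's verbatim blocks in
`BIJ88Sect5StatementsPart4`, `BIJ88ScalarTransl582`, `BIJ88ScalarSummary583`, `BIJ88IdentityB1p296Proof`).  [7] = T. Bałaban, *(Higgs)₂,₃ quantum
fields in a finite volume I*, Commun. Math. Phys. **85** (1982) 603–626 [Balaban1982Higgs1] (journal page = PDF page + 602), pp. 608–612, as quoted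
verbatim in `Balaban1983to89.B1RG242`; [I] = [BalabanImbrieJaffe1985] (Commun. Math. Phys. **97**) (2.6)/(2.9) p. 303, (4.6.1)–(4.6.4) p. 313 as
quoted in p11's `BIJ85BlockAveragesTorusK` / `BIJ85PropagatorRG242`.

**What the paper prints (pp. 295–296, verbatim, owner's reading).**  *"To eliminate most of the linear term ⟨ψ, Q(ũ_{k+1})φ⟩ in the small field
region, we make a translation φ = φ^{(k)} + aL^{−2}Λ₇^{(k)}C^{(k)}_{loc}(u_{k+1})Q^*(u_{k+1})ψ. (5.8.1) (Recall that u_{k+1} = ũ_{k+1} in Λ̄₆^{(k)}.) …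
We apply the identity [7] aL^{−2}I − a²L^{−4}Q(u_{k+1})C^{(k)}(u_{k+1})Q(u_{k+1})^* = a_kL^{−2}I − a_k²L^{−4}Q_{k+1}(u_{k+1})G^η_{k+1}(u_{k+1})Q_{k+1}(u_{k+1})^*,
but in a localized version with C^{(k)}_{loc} and G^η_{k+1,loc} and with another small kernel w₇″ on the right. This yields the desired form
Δ^L_{k+1,loc}(u_{k+1}) … To summarize, we have written ½⟨Λ₈^{(k−1)′}φ, Δ_{k,loc}(ũ_{k+1})Λ₈^{(k−1)′}φ⟩ + ½aL^{−2}⟨ψ − Q(ũ_{k+1})φ, ψ − Q(ũ_{k+1})φ⟩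
= 𝒬₄ + 𝒬₅ + 𝒬₆ + ½⟨Λ₈^{(k−1)′}φ^{(k)}, (Δ_{k,loc}(ũ_{k+1}) + aL^{−2}P(ũ_{k+1}))Λ₈^{(k−1)′}φ^{(k)}⟩ + ½⟨Λ₈^{(k)″}ψ, Δ^L_{k+1,loc}(u_{k+1})Λ₈^{(k)′}ψ⟩
+ ⟨φ^{(k)}, w₆ψ⟩ + ½⟨ψ, w₇ψ⟩, (5.8.3)"* (reading rulings of the row: the right-hand constant of the identity is `a_{k+1} = aa_k/(aL^{−2} + a_k)` of [7]
(2.13), GAPS G-C2-07; `Λ₈^{(k)″}` read `Λ₈^{(k)′}`, G-C2-13).  [7] p. 611: *"It is not clear from the formulas (2.30), (2.31) that the covariances are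
well defined. It is so, and it is one of the assertions of Proposition 2.3."*

V1.1 (p29 gen 40, `literature-prover-lit-balaban-p29-g40-0`, 2026-08-24): DOC-ONLY — referee ref-1 gen 116 nits N-ref1-g116-1 (the p. 295
sentence quotes *"the linear term ⟨ψ, Q(ũ_{k+1})φ⟩"* with the tilde, as printed; re-read on the ×2 render `lit-balaban-ref-1/renders/cmp114/original-p039-x2.png`)
and N-ref1-g116-2 (the `eq583_torus` docstring now quotes (5.8.3)'s left slot `Λ₈^{(k)″}ψ` as printed and says that G-C2-13 is applied);
declarations unchanged.

CITATION HEADER (lean-in-tree rule).  Part of the lit-balaban TYPED SKELETON (HOME `run/shared/lean/pub/lit-balaban/`), PHASE-2 proof seat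
p29 gen 36 (`literature-prover-lit-balaban-p29-g36-0`; TAKING line HOME/STATUS.md 2026-08-23T18:11Z, free-target protocol G.5-34(d); own lineage:
gen-35 HANDOFF item (3)).  Rows: **C2.Eq5.8.1-5.8.3** of `HOME/lit-balaban-r16/ROWS-C2-part2.md` (fold owner r16; head already `proved` by p02's
`transl581`/`eq582`/`Ops.eq583`/`BIJ88IdentityB1p296Proof` — this file is a MEMBER, zero head weight) and, as a covariant member, the B1 rows of
[7] (2.41)/(2.42) and (2.18)–(2.21) (`HOME/lit-balaban-r14`, owner r14).  WHY THIS FILE: p02's (5.8.3) `Ops.eq583` and the identity of [7]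
`identityB1p296_step` live on ABSTRACT carriers (`Ops`, resp. `B1RG242.StepData` with the hypotheses `QQ^* = 1`, invertibility); gen 35's
`BIJ88BasicForms331OpsTorus` instantiated them at STEP 0 only, where the identity of [7] is definitional (header (iii) there: *«the general-k instance
… is NOT built here»*); `B1RG242Torus` discharges the `B1RG242` hypotheses only for the SCALAR tower `U = 1` (its NOT-CERTIFIED (i): *«the
GAUGE-COVARIANT operators … are NOT constructed»*); p11's `BIJ85PropagatorRG242` / `BIJ85ScalarFormSemigroup` prove (2.41)/(2.42) and the
variational semigroup on the C1 `PiLp` carriers.  THIS FILE does it for the U(1)-COVARIANT torus MATRICES OF RECORD of the C2 lane (p31's `qMatT`,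
`nOp`, `deltaRegion`, `deltaLocT`, `gLocT`, `pOp`, `op240`, `proj`; gen 34's `lapU`, `cLocC`; p11's `lineIter`, `qCovK`) at a general step `k`.

WHAT IS REPRODUCED (kernel-checked; 0 `sorry`; no `Prop`-valued definition; standard axioms).
* §1 KERNEL FACTS at level `k`: **`qMatT_one_mul_conjTranspose`** — `Q(u)Q(u)ᴴ = L^{−d}·1` for the one-step covariant average ([I] (2.9)
  `QQ^* = I` for the weighted adjoint `Q^* = L^dQᴴ`); **`qMatT_succ`** — `Q_{k+1}(u) = Q(u^{(k)})Q_k(u)` AT MATRIX LEVEL ([7] (2.12)/(2.14); p11's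
  `qCovK_succ`); **`proj_mul_pOp_comm`** — `[1_{Λ₈}, Q(u)ᴴQ(u)] = 0` when `Λ₈` is a union of blocks (the reading of (5.8.2) accepted by the owner,
  PROVED); `realify₂_injective`; **`isUnit_nOp_univ`** / `gBox_univ_eq_inv` (p31's whole-torus propagator `G_k(T,u) = (−Δ_u + aQ_kᴴQ_k)⁻¹`);
  `isUnit_realify` / `isUnit_of_isUnit_realify`; `nOp_univ_eq_lapU`.
* §2 **`stepT κ α c U k : B1RG242.StepData ℝ …`** — [7]'s one-step data at the covariant torus operators, REALIFIED (gen 35's `realify₂`):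
  `H = realify(D_uᴴD_u)`, `Q_k = realify₂ Q_k(u)`, `Q_k^* = realify₂ Q_k(u)ᴴ`, `Q = realify₂ Q(u^{(k)})`, `Q^* = N·realify₂ Q(u^{(k)})ᴴ` (`N = L^d`),
  `α`, `β = κ/N`; the DICTIONARY `stepT_G_arg` / `stepT_Gk` / `stepT_Δk` / `stepT_βP` / `stepT_C_arg` / `stepT_Qk1` / `stepT_Qk1s` / `stepT_next_arg` /
  `stepT_Ck` / `stepT_Gk1` (every derived object of `B1RG242` IS the realification of the matrix of record: `G_k = (nOp α c U k univ)⁻¹`,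
  `Δ^{(k)} = deltaRegion α c U k univ`, the argument of `C^{(k)}` = **`cArgT`** `= op240 (deltaRegion α c U k univ) κ u^{(k)}`, `C^{(k)} =` **`cT`**,
  `Q_{k+1} = qMatT U (k+1)`, `G_{k+1} = (nOp a′ c U (k+1) univ)⁻¹` with **`aNext`** `a′ = ακN/(αN + κ)` = [7] (2.13) in the tree's normalization,
  `stepT_γ_mul_bN`); the HYPOTHESES OF `B1RG242` DISCHARGED: **`stepT_QQs`** (`QQ^* = 1`), **`stepT_scalarProducts`** (`StepData.ScalarProducts`
  for the weights `1, 1, N·1`: positivity, `⟨φ, −Δ_uφ⟩ ≥ 0` by gen 34's `form_lapU`, adjointness via `realify₂_conjTranspose`), **`stepT_isUnit_next`**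
  (`G_{k+1}` exists, p31's `gBox_univ_mul` one level up); HENCE **`isUnit_cArgT`** — [7] p. 611 *"It is so"* for these operators
  (`B1RG242.StepData.isUnit_C_of_next`, pulled back along the realification), **`ident_torus`** — THE IDENTITY OF [7] QUOTED ON p. 296 as a
  complex-matrix identity on `ℓ²(T^{(j+k+1)})`: `κ·1 − κ²·Q(u^{(k)})C^{(k)}(u)Q(u^{(k)})ᴴ = a′·1 − a′²·Q_{k+1}(u)G_{k+1}(T,u)Q_{k+1}(u)ᴴ`
  (`B1RG242.StepData.display221_succ`, rescaled by `N`), and **`rg242_torus`** / **`rg241_torus`** — [7] (2.42)/(2.41) for these operators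
  (`display242_of_next` / `display241_of_next`).
* §3 **`opsK`** — p02's `Ops` AT STEP `k` on the realified carriers `E T^{(j+k)}`, `E T^{(j+k+1)}`, `E T^{(j)}` (every slot the `RL` of a matrix of record,
  see its docstring; the `Δ`-slot takes any Hermitian unit-lattice kernel — of record `Δ_{k,loc}(ũ_{k+1}) = deltaLocT α c ũ k …`), `T_eq` /
  `cplx_T_apply`, **`transl581T`** ((5.8.1) as a complex field) with `cplx_transl_eq` and **`transl581T_eq_transl581`** (IT IS r16's typed `transl581`
  at the kernels read as real-linear maps, `κ = aL^{−2}`), **`deltaLloc_eq_RL_deltaLocT`** (p02's `Δ^L_{k+1,loc}` IS p31's (2.34) one level up at the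
  constant `a′`), **`opsK_laws`** — ALL NINE `Ops.Laws` PROVED (`Λ8P` by `proj_mul_pOp_comm`, `ident` by `ident_torus`), `opsK_laws_deltaLocT` (the
  `Δ`-slot of record is admissible by p31's `deltaLocT_conjTranspose`).
* §4 **`negl583`** (`𝒬₄ + 𝒬₅ + 𝒬₆ + ⟨φ^{(k)}, w₆ψ⟩ + ½⟨ψ, w₇ψ⟩` at the instance, explicit real number), `scalarForms_opsK_eq`, `mainFormPhi_opsK_eq`,
  `mainFormPsi_opsK_eq`, and **`eq583_torus`** / `eq583_torus_transl581` — (5.8.3) IN COMPLEX COORDINATES AT THE KERNELS OF RECORD: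
  `½ Re (1_{Λ₈}φ)ᴴΔ(1_{Λ₈}φ) + ½κΣ_y‖ψ(y) − (Q(u^{(k)})φ)(y)‖²` at `φ = transl581T … φ^{(k)} ψ` EQUALS `½ Re (1_{Λ₈}φ^{(k)})ᴴ(Δ + κP(u^{(k)}))(1_{Λ₈}φ^{(k)}) +
  ½ Re (1_{Λ₈′}ψ)ᴴ Δ_{k+1,loc}(u)[a′] (1_{Λ₈′}ψ) + negl583`.

HONEST SCOPE.  (i) Sizes/ranges of `w₆`, `w₇`, `𝒬₄`–`𝒬₆` (*"small local kernels"*, *"localized near Λ₈^{(k)′c}"*) are NOT claimed (`negl583` is an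
explicit number, not a bound; the (2.47)-type closeness of `C_loc`, `G_loc` is rows (2.35)/(2.47)).  (ii) NORMALIZATION: the tree's torus objects carry
uniform (counting) weights (p31 gen 10/15, gen 35): `Q_k(u)` has entries `L^{−kd}u(Γ)`, adjoints are conjugate transposes, `Δ_k(u) = α·1 − α²·Q_kG_kQ_kᴴ`
with `G_k = (−Δ_u + αQ_kᴴQ_k)⁻¹`; the print's weighted constants are `α = a_kL^{kd}` etc. (as in `Balaban1983to89.B4Delta112ZeroTorusCube`), and in
this normalization [7] (2.13) reads `a′ = ακN/(αN + κ)`, `N = L^d = |B(y)|` (the weighted adjoint `Q^* = N·Qᴴ` inside `stepT` is exactly what makes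
`QQ^* = 1`); the identities proved are exact algebraic identities between the tree's objects with these explicit constants.  (iii) `u_{k+1} = ũ_{k+1}`:
as in p02's `Ops` (and the paper's "Recall that u_{k+1} = ũ_{k+1} in Λ̄₆"), ONE field `u` drives `Q`, `P`, `C^{(k)}`, `Q_{k+1}`, `G_{k+1}`; the `Δ`-slot
(`Δ_{k,loc}(ũ_{k+1})`) is a free Hermitian kernel.  (iv) Whole torus for `C^{(k)}(u)`, `G_k`, `G_{k+1}` (no Dirichlet/Neumann region: [7]'s `Ω` = `T`);
`Λ`, `M`, `ρ` (walk data of `C_loc`), `Λ₇`, `Λ₈` (a union of blocks), `Λ₈′`, `cube`/`lam`/`ζ″` free.  (v) Standing range `j + k + 1 ≤ m + K`, `α, κ > 0`,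
`c ≠ 0`, any `d ≥ 1`, `U(1)`.  Imports Literature only; re-declares nothing (`StepData` and its API, `Ops`/`Ops.Laws`/`Ops.eq583`, `transl581`,
`realify₂`/`RL`/`E`/`toE`, all torus kernels BY NAME); NOT summit progress; NOT continuum; NOT Clay.
-/

open scoped BigOperators Matrix ComplexConjugate RealInnerProductSpace
open Finset Matrix

namespace Literature.MathematicalPhysics.QuantumFieldTheory.BalabanImbrieJaffe1984to88.BIJ88ScalarSummary583OpsTorus

open Literature.MathematicalPhysics.QuantumFieldTheory.Balaban1983to89
open BIJ88Sect3Statements (U1 toC cfg covD)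
open BIJ85BlockAveragesTorus (qCov)
open BIJ85BlockAveragesTorusK (qCovK qCovK_one qCovK_succ lineIter holCK blockK blkIter card_blockK norm_holCK mem_blockK)
open BIJ88NeumannPropagator227Torus (nOp nOp_eq dN qMatK proj proj_mulVec proj_conjTranspose proj_mul_proj gBox gBox_univ_mul cproj)
open BIJ88DeltaLoc234Torus (qMatT qMatT_mulVec qMatT_apply deltaLocT gLocT deltaRegion deltaLocT_conjTranspose)
open BIJ88NeumannNoZeroModesTorus (IsBlockUnion)
open BIJ88Eq240FlatTorus (realify cplx cplx_realify_mulVec dotProduct_eq_re pOp op240)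
open BIJ88Decay241FlatTorus (realify_one realify_inv realify_mul)
open BIJ88ScalarTranslation330Torus (lapU lapU_isHermitian form_lapU cLocC)
open BIJ88BasicForms331OpsTorus (realify₂ realify₂_eq_realify realify₂_apply realify₂_mul realify₂_conjTranspose realify₂_add
  realify₂_sub realify₂_smul realify₂_one reim cplx_reim reim_cplx cplx_realify₂_mulVec dotProduct_realify₂_mulVec E RL ofLp_RL
  cplx_ofLp_RL inner_RL inner_RL_left RL_mul RL_one RL_add RL_sub RL_smul eq_RL_of_cplx cplx_injective toE cplx_ofLp_toE
  inner_self_eq_sum_norm_sq cplx_add cplx_sub cplx_smul)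
open BIJ88ScalarSummary583 (Ops)
open BIJ88Sect5StatementsPart4 (transl581)
open B1RG242 (StepData)

noncomputable section

variable {P : Params} {j : ℕ}

/-! ## §1  Kernel facts at level `k` on the torus of record -/

section Kernels

/-- kernel: the block cardinality `L^d` as a real number is positive (`1 < L`). [cite: Balaban1982Higgs1, (1.17) p.606] -/
theorem Ld_pos : 0 < ((P.L : ℝ) ^ P.d) := pow_pos (by exact_mod_cast lt_trans zero_lt_one P.hL.2) _

/-- kernel: `L^d ≠ 0` in `ℂ`. [cite: Balaban1982Higgs1, (1.17) p.606] -/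
theorem Ld_ne_zero_C : ((P.L : ℂ) ^ P.d) ≠ 0 := pow_ne_zero _ (by exact_mod_cast (lt_trans zero_lt_one P.hL.2).ne')

/-- **`Q(u)Q(u)ᴴ = L^{−d}·1` for the one-step covariant average** of [I] (2.6) on `T^{(j)} → T^{(j+1)}` (every `U(1)` field `u`; the tree's
uniform-weight adjoint `Qᴴ`, so that the print's weighted adjoint `Q^* = L^dQᴴ` of [B1] (1.5) gives `QQ^* = I` = [I] (2.9)): the rows of `Q(u)` are
supported on the disjoint blocks `B(y)`, `|B(y)| = L^d`, `|u| = 1`. [cite: BalabanImbrieJaffe1985, (2.9) p.303] -/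
theorem qMatT_one_mul_conjTranspose (hj : j + 1 ≤ P.m + P.K) (W : GaugeField P j U1) :
    qMatT W 1 * (qMatT W 1)ᴴ = (((P.L : ℂ) ^ P.d)⁻¹) • (1 : Matrix _ _ ℂ) := by
  ext y y'
  rw [mul_apply, Matrix.smul_apply, smul_eq_mul]
  by_cases hy : y = y'
  · subst hy
    rw [one_apply_eq, mul_one]
    have hterm : ∀ x, qMatT W 1 y x * (qMatT W 1)ᴴ x y =
        if x ∈ blockK 1 y then ((((P.L : ℂ) ^ P.d)⁻¹) ^ 2 : ℂ) else 0 := by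
      intro x
      rw [conjTranspose_apply, qMatT_apply]
      split_ifs with hx
      · have hh : holCK W 1 x * (starRingEnd ℂ) (holCK W 1 x) = 1 := by
          rw [Complex.mul_conj, Complex.normSq_eq_norm_sq, norm_holCK, one_pow, Complex.ofReal_one]
        have hc : (starRingEnd ℂ) (((P.L : ℂ) ^ P.d)⁻¹) = ((P.L : ℂ) ^ P.d)⁻¹ := by
          rw [map_inv₀, map_pow, Complex.conj_natCast]
        rw [one_mul, star_mul', mul_mul_mul_comm, Complex.star_def, hh, mul_one, hc, sq]
      · rw [star_zero, mul_zero]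
    rw [Finset.sum_congr rfl fun x _ => hterm x, Finset.sum_ite_mem, Finset.univ_inter, Finset.sum_const, card_blockK 1 hj y,
      nsmul_eq_mul, one_mul]
    push_cast
    rw [sq, ← mul_assoc, mul_inv_cancel₀ Ld_ne_zero_C, one_mul]
  · rw [one_apply_ne hy, mul_zero]
    refine Finset.sum_eq_zero fun x _ => ?_
    rw [conjTranspose_apply, qMatT_apply, qMatT_apply]
    by_cases h1 : x ∈ blockK 1 y
    · have h2 : x ∉ blockK 1 y' := fun h2 => hy ((mem_blockK.1 h1).symm.trans (mem_blockK.1 h2))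
      rw [if_neg h2, star_zero, mul_zero]
    · rw [if_neg h1, zero_mul]

/-- kernel: a matrix is determined by its action on vectors. [cite: BalabanImbrieJaffe1985, (4.6.1) p.313] -/
private theorem ext_of_mulVec {m n : Type*} [Fintype n] [DecidableEq n] {A B : Matrix m n ℂ} (h : ∀ v, A *ᵥ v = B *ᵥ v) : A = B := by
  ext i k
  have := congrFun (h (Pi.single k 1)) i
  rwa [mulVec_single_one, mulVec_single_one] at this

/-- **`Q_{k+1}(u) = Q(u^{(k)})·Q_k(u)` AT MATRIX LEVEL** — [7] = [B1] p. 609 (2.12)/(2.14) (composition of the block averages along the concatenated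
contours), [I] p. 309 *"the k-fold composition of the 1-step averaging operators"*: p11's `qCovK_succ` read on p31's matrices `qMatT`, the next
one-step average taken with the iterated line field `u^{(k)}` = p11's `lineIter U k` on `T^{(j+k)}`. [cite: Balaban1982Higgs1, (2.14) p.609] -/
theorem qMatT_succ (U : GaugeField P j U1) (k : ℕ) : qMatT U (k + 1) = qMatT (lineIter U k) 1 * qMatT U k := by
  refine ext_of_mulVec fun φ => ?_
  rw [← mulVec_mulVec]
  funext y
  have h1 : qMatT U k *ᵥ φ = qCovK U k φ := funext fun z => qMatT_mulVec U k φ z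
  rw [qMatT_mulVec, h1, qMatT_mulVec, qCovK_one, qCovK_succ]

/-- **`[1_{Λ₈}, P(u)] = 0` WHEN `Λ₈` IS A UNION OF BLOCKS** — the reading of (5.8.2) accepted by the row owner (`Λ₈^{(k−1)′c}P(ũ_{k+1})` as a
characteristic-function multiplication commuting with the block operator `P = Q^*Q` on block unions; p02's `Ops.Laws.Λ8P`), PROVED for p31's
`P(u) = Q(u)ᴴQ(u)`: its kernel couples only sites of the same block. [cite: BalabanImbrieJaffe1988, (5.8.2) p.295] -/
theorem proj_mul_pOp_comm {n : ℕ} (W : GaugeField P n U1) {Λ₈ : Finset (Balaban1983to89.Site P n)} (hΛ : IsBlockUnion 1 Λ₈) :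
    proj Λ₈ * pOp W = pOp W * proj Λ₈ := by
  have hblk : ∀ x x' : Balaban1983to89.Site P n, pOp W x x' ≠ 0 → blkIter 1 x = blkIter 1 x' := by
    intro x x' hne
    by_contra hxx
    apply hne
    rw [pOp, mul_apply]
    refine Finset.sum_eq_zero fun y _ => ?_
    rw [conjTranspose_apply, qMatT_apply, qMatT_apply]
    by_cases h1 : x ∈ blockK 1 y
    · have h2 : x' ∉ blockK 1 y := fun h2 => hxx ((mem_blockK.1 h1).trans (mem_blockK.1 h2).symm)
      rw [if_neg h2, mul_zero]
    · rw [if_neg h1, star_zero, zero_mul]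
  have hmem : ∀ x x' : Balaban1983to89.Site P n, blkIter 1 x = blkIter 1 x' → (x ∈ Λ₈ ↔ x' ∈ Λ₈) := by
    intro x x' h
    constructor
    · intro hx; exact hΛ x hx (mem_blockK.2 h.symm)
    · intro hx'; exact hΛ x' hx' (mem_blockK.2 h)
  ext x x'
  unfold proj
  rw [diagonal_mul, mul_diagonal]
  by_cases hP : pOp W x x' = 0
  · rw [hP, mul_zero, zero_mul]
  · have h := hmem x x' (hblk x x' hP)
    by_cases hx : x ∈ Λ₈
    · rw [if_pos hx, if_pos (h.1 hx), one_mul, mul_one]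
    · rw [if_neg hx, if_neg (fun hx' => hx (h.2 hx')), zero_mul, mul_zero]

/-- kernel: the rectangular realification is injective (its `(·,0)(·,0)` and `(·,1)(·,0)` blocks are `Re A` and `Im A`).
[cite: BalabanImbrieJaffe1988, (4.9) p.275] -/
theorem realify₂_injective {m n : Type*} : Function.Injective (realify₂ : Matrix m n ℂ → Matrix (m × Fin 2) (n × Fin 2) ℝ) := by
  intro A B h
  ext i k
  apply Complex.ext
  · have := congrFun (congrFun h (i, 0)) (k, 0)
    simpa [realify₂_apply] using this
  · have := congrFun (congrFun h (i, 1)) (k, 0)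
    simpa [realify₂_apply] using this

/-- kernel: a square complex matrix with a right inverse is a unit. [cite: BalabanImbrieJaffe1988, (2.27) p.263] -/
private theorem isUnit_of_mul_eq_one' {n : Type*} [Fintype n] [DecidableEq n] {R : Type*} [CommRing R] {A B : Matrix n n R}
    (h : A * B = 1) : IsUnit A :=
  (Matrix.isUnit_iff_isUnit_det A).2 (Matrix.isUnit_det_of_right_inverse h)

/-- **On the whole torus the Neumann operator `−Δ_u + aQ_k(u)ᴴQ_k(u)` is invertible** (`a > 0`, `c ≠ 0`, standing range) — p31's two-sided
inverse `gBox a c U k univ` (`gBox_univ_mul`); [B1] p. 610 (2.20) `G^ε_k` exists. [cite: Balaban1982Higgs1, (2.20) p.610] -/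
theorem isUnit_nOp_univ {k : ℕ} (hk : j + k ≤ P.m + P.K) {a c : ℝ} (hc : c ≠ 0) (ha : 0 < a) (U : GaugeField P j U1) :
    IsUnit (nOp a c U k univ) :=
  isUnit_of_mul_eq_one' (gBox_univ_mul hk hc ha U).2

/-- kernel: on the whole torus p31's `G_k(T,u) = gBox a c U k univ` IS `(nOp a c U k univ)⁻¹`. [cite: Balaban1982Higgs1, (2.20) p.610] -/
theorem gBox_univ_eq_inv {k : ℕ} (hk : j + k ≤ P.m + P.K) {a c : ℝ} (hc : c ≠ 0) (ha : 0 < a) (U : GaugeField P j U1) :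
    gBox a c U k univ = (nOp a c U k univ)⁻¹ :=
  (Matrix.inv_eq_left_inv (gBox_univ_mul hk hc ha U).1).symm

/-- kernel: `realify` preserves units. [cite: BalabanImbrieJaffe1988, (4.9) p.275] -/
theorem isUnit_realify {n : Type*} [Fintype n] [DecidableEq n] {M : Matrix n n ℂ} (hM : IsUnit M) : IsUnit (realify M) := by
  have hdet : IsUnit M.det := (Matrix.isUnit_iff_isUnit_det M).1 hM
  exact isUnit_of_mul_eq_one' (B := realify M⁻¹) (by rw [← realify_mul, Matrix.mul_nonsing_inv _ hdet, realify_one])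

/-- kernel: conversely, `M` is a unit as soon as `realify M` is (injectivity of `φ ↦ Mφ` read in real coordinates).
[cite: BalabanImbrieJaffe1988, (4.9) p.275] -/
theorem isUnit_of_isUnit_realify {n : Type*} [Fintype n] [DecidableEq n] {M : Matrix n n ℂ} (hM : IsUnit (realify M)) : IsUnit M := by
  rw [← Matrix.mulVec_injective_iff_isUnit] at hM ⊢
  intro v w hvw
  have h : realify M *ᵥ reim v = realify M *ᵥ reim w := by
    apply cplx_injective
    rw [← realify₂_eq_realify, cplx_realify₂_mulVec, cplx_realify₂_mulVec, cplx_reim, cplx_reim, hvw]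
  have := hM h
  rw [← cplx_reim v, ← cplx_reim w, this]

/-- kernel: `nOp a c U k univ = −Δ_u + a·Q_k(u)ᴴQ_k(u)` with `−Δ_u = lapU c U` (gen 34's Gram matrix of `dN c U univ`).
[cite: BalabanImbrieJaffe1985, (4.6.2) p.313] -/
theorem nOp_univ_eq_lapU (a c : ℝ) (U : GaugeField P j U1) (k : ℕ) :
    nOp a c U k univ = lapU c U + (a : ℂ) • ((qMatT U k)ᴴ * qMatT U k) := by
  rw [nOp_eq]; rfl

end Kernels

/-! ## §2  [7]'s one-step data `B1RG242.StepData` at the U(1)-covariant torus operators of level `k`, realified; the identity of [7] -/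

section Step

variable (κ α c : ℝ) (U : GaugeField P j U1) (k : ℕ)

/-- the block cardinality `N = L^d = |B(y)|` (the norm of the unweighted adjoint: `QQᴴ = N^{−1}`). [cite: Balaban1982Higgs1, (1.17) p.606] -/
def bN (P : Params) : ℝ := (P.L : ℝ) ^ P.d

/-- **the next constant `a′`** — [7] (2.13) `a_{k+1} = aa_k/(aL^{−2} + a_k)` in the tree's normalization (uniform lattice weights, the block sum
`N = L^d` carried by the unweighted adjoint): `a′ = ακN/(αN + κ)`, `α` = the constant of `Δ_k(u)`, `κ` = the printed `aL^{−2}`; it is `γ·N` for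
[7]'s `γ = αβ/(α + β)` at `β = κ/N` (`stepT_γ_mul_bN`). (Row owner's ruling G-C2-07: the right-hand constant of the identity quoted on p. 296 is
`a_{k+1}`.) [cite: Balaban1982Higgs1, (2.13) p.609] -/
def aNext (P : Params) (κ α : ℝ) : ℝ := α * κ * bN P / (α * bN P + κ)

/-- **THE ARGUMENT OF `C^{(k)}(u)`** — [7] (2.31) *"C^{(k)}(Ω,A) = (aL^{−2}P(A) + Δ^{(k)}(Ω,A))^{−1}"* on the whole unit torus `T^{(j+k)}`: p31's
(2.40)-shape `op240 Δ κ u^{(k)} = Δ + κ·Q(u^{(k)})ᴴQ(u^{(k)})` at the UNlocalized `Δ = Δ_k(T,u) = deltaRegion α c U k univ` ([I] (4.6.4) with the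
whole-torus propagator). [cite: Balaban1982Higgs1, (2.31) p.611] -/
def cArgT : Matrix (Balaban1983to89.Site P (j + k)) (Balaban1983to89.Site P (j + k)) ℂ :=
  op240 (deltaRegion α c U k univ) κ (lineIter U k)

/-- **`C^{(k)}(u)`** = [7] (2.31) on the unit torus of level `k`: `(κQ(u^{(k)})ᴴQ(u^{(k)}) + Δ_k(T,u))^{−1}` (Mathlib `Matrix.inv`; a genuine inverse
by `isUnit_cArgT` — [7] p. 611 *"It is so"*). [cite: Balaban1982Higgs1, (2.31) p.611] -/
def cT : Matrix (Balaban1983to89.Site P (j + k)) (Balaban1983to89.Site P (j + k)) ℂ := (cArgT κ α c U k)⁻¹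

/-- **[7]'s ONE-STEP DATA AT THE U(1)-COVARIANT TORUS OPERATORS OF RECORD, level `k`, REALIFIED** (`B1RG242.StepData` over `ℝ` on the real
coordinates of the complex site functions, two per site): `H = −Δ_u = D_uᴴD_u` on the `η`-lattice `T^{(j)}` (gen 34's `lapU c U`), `Q_k = Q_k(u)`
(p31's `qMatT U k`), `Q_k^* = Q_k(u)ᴴ`, `Q = Q(u^{(k)})` (the one-step covariant average of the unit lattice `T^{(j+k)}` with p11's iterated line
field `lineIter U k`), `Q^* = N·Q(u^{(k)})ᴴ` (the WEIGHTED adjoint of [7] (1.5), `N = L^d`, so that `QQ^* = 1`), `α` = the constant of `Δ_k(u)`,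
`β = κ/N`. [cite: Balaban1982Higgs1, (2.7) p.608, (2.11) p.609, (2.17)/(2.20) p.610, (2.30) p.611] -/
def stepT : StepData ℝ (Balaban1983to89.Site P j × Fin 2) (Balaban1983to89.Site P (j + k) × Fin 2)
    (Balaban1983to89.Site P (j + k + 1) × Fin 2) where
  H := realify₂ (lapU c U)
  Qk := realify₂ (qMatT U k)
  Qks := realify₂ (qMatT U k)ᴴ
  Q := realify₂ (qMatT (lineIter U k) 1)
  Qs := bN P • realify₂ (qMatT (lineIter U k) 1)ᴴ
  α := α
  β := κ / bN P

variable {κ α c U k}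

/-- kernel: `bN P ≠ 0`. [cite: Balaban1982Higgs1, (1.17) p.606] -/
theorem bN_ne_zero : bN P ≠ 0 := (Ld_pos (P := P)).ne'

/-- kernel: `(bN : ℂ) = L^d`. [cite: Balaban1982Higgs1, (1.17) p.606] -/
theorem bN_cast : ((bN P : ℝ) : ℂ) = (P.L : ℂ) ^ P.d := by unfold bN; push_cast; rfl

/-- dictionary: `H + αP_k = realify(−Δ_u + αQ_k(u)ᴴQ_k(u)) = realify (nOp α c U k univ)` (the argument of `G_k(u)`, [7] (2.20)).
[cite: Balaban1982Higgs1, (2.20) p.610] -/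
theorem stepT_G_arg : (stepT κ α c U k).H + (stepT κ α c U k).α • (stepT κ α c U k).Pk = realify (nOp α c U k univ) := by
  show realify₂ (lapU c U) + α • (realify₂ (qMatT U k)ᴴ * realify₂ (qMatT U k)) = _
  rw [← realify₂_mul, ← realify₂_smul, ← realify₂_add, nOp_univ_eq_lapU, realify₂_eq_realify]

/-- dictionary: `G_k = realify (nOp α c U k univ)⁻¹ = realify G_k(T,u)` (standing range, `α > 0`, `c ≠ 0`). [cite: Balaban1982Higgs1, (2.20) p.610] -/
theorem stepT_Gk (hk : j + k ≤ P.m + P.K) (hc : c ≠ 0) (hα : 0 < α) : (stepT κ α c U k).Gk = realify (nOp α c U k univ)⁻¹ := by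
  rw [StepData.Gk, stepT_G_arg, realify_inv (isUnit_nOp_univ hk hc hα U)]

/-- dictionary: `Δ^{(k)} = realify Δ_k(T,u)` — [7] (2.21) IS p31's whole-torus (2.35)/[I] (4.6.4) `deltaRegion α c U k univ = α·1 − α²·Q_kG_k(T,u)Q_kᴴ`.
[cite: Balaban1982Higgs1, (2.21) p.610] -/
theorem stepT_Δk (hk : j + k ≤ P.m + P.K) (hc : c ≠ 0) (hα : 0 < α) : (stepT κ α c U k).Δk = realify (deltaRegion α c U k univ) := by
  rw [StepData.Δk, stepT_Gk hk hc hα]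
  show α • (1 : Matrix _ _ ℝ) - α ^ 2 • (realify₂ (qMatT U k) * realify₂ (nOp α c U k univ)⁻¹ * realify₂ (qMatT U k)ᴴ) = _
  have hsq : ((α : ℂ) ^ 2) = ((α ^ 2 : ℝ) : ℂ) := by push_cast; ring
  rw [← realify₂_mul, ← realify₂_mul, ← realify₂_one, ← realify₂_smul, ← realify₂_smul, ← realify₂_sub, deltaRegion,
    gBox_univ_eq_inv hk hc hα, hsq, realify₂_eq_realify]

/-- dictionary: `βP = realify(κ·Q(u^{(k)})ᴴQ(u^{(k)})) = realify (κ·pOp (lineIter U k))` (`β = κ/N` against the weighted `Q^* = N·Qᴴ`).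
[cite: Balaban1982Higgs1, (2.30) p.611] -/
theorem stepT_βP : (stepT κ α c U k).β • (stepT κ α c U k).P = realify ((κ : ℂ) • pOp (lineIter U k)) := by
  show (κ / bN P) • (bN P • realify₂ (qMatT (lineIter U k) 1)ᴴ * realify₂ (qMatT (lineIter U k) 1)) = _
  rw [Matrix.smul_mul, smul_smul, div_mul_cancel₀ _ bN_ne_zero, ← realify₂_mul, ← realify₂_smul, pOp, realify₂_eq_realify]

/-- dictionary: `βP + Δ^{(k)} = realify (cArgT κ α c U k)` — the argument of [7]'s `C^{(k)}` (2.30)/(2.31) IS p31's (2.40)-shape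
`op240 (deltaRegion α c U k univ) κ u^{(k)}`. [cite: Balaban1982Higgs1, (2.30) p.611] -/
theorem stepT_C_arg (hk : j + k ≤ P.m + P.K) (hc : c ≠ 0) (hα : 0 < α) :
    (stepT κ α c U k).β • (stepT κ α c U k).P + (stepT κ α c U k).Δk = realify (cArgT κ α c U k) := by
  rw [stepT_βP, stepT_Δk hk hc hα, cArgT, op240, ← realify₂_eq_realify, ← realify₂_eq_realify, ← realify₂_eq_realify,
    ← realify₂_add, add_comm (deltaRegion α c U k univ)]

/-- dictionary: `QQ^* = 1` ([7]/[I] (2.9)) for the realified one-step average with its weighted adjoint. [cite: BalabanImbrieJaffe1985, (2.9) p.303] -/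
theorem stepT_QQs (hk : j + k + 1 ≤ P.m + P.K) : (stepT κ α c U k).Q * (stepT κ α c U k).Qs = 1 := by
  show realify₂ (qMatT (lineIter U k) 1) * (bN P • realify₂ (qMatT (lineIter U k) 1)ᴴ) = 1
  have hcast : (((P.L : ℂ) ^ P.d)⁻¹) = (((bN P)⁻¹ : ℝ) : ℂ) := by rw [Complex.ofReal_inv, bN_cast]
  rw [Matrix.mul_smul, ← realify₂_mul, qMatT_one_mul_conjTranspose hk, hcast, realify₂_smul, realify₂_one, smul_smul,
    mul_inv_cancel₀ bN_ne_zero, one_smul]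

/-- dictionary: `Q_{k+1} = QQ_k = realify₂ Q_{k+1}(u)` (p31's `qMatT U (k+1)`, by `qMatT_succ`). [cite: Balaban1982Higgs1, (2.14) p.609] -/
theorem stepT_Qk1 : (stepT κ α c U k).Qk1 = realify₂ (qMatT U (k + 1)) := by
  show realify₂ (qMatT (lineIter U k) 1) * realify₂ (qMatT U k) = _
  rw [← realify₂_mul, ← qMatT_succ]

/-- dictionary: `Q_{k+1}^* = Q_k^*Q^* = N·realify₂ Q_{k+1}(u)ᴴ`. [cite: Balaban1982Higgs1, (2.14) p.609] -/
theorem stepT_Qk1s : (stepT κ α c U k).Qk1s = bN P • realify₂ (qMatT U (k + 1))ᴴ := by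
  show realify₂ (qMatT U k)ᴴ * (bN P • realify₂ (qMatT (lineIter U k) 1)ᴴ) = _
  rw [Matrix.mul_smul, ← realify₂_mul, ← conjTranspose_mul, ← qMatT_succ]

/-- dictionary: `γ·N = a′` ([7] (2.13) in the tree's normalization). [cite: Balaban1982Higgs1, (2.13) p.609] -/
theorem stepT_γ_mul_bN (hα : 0 < α) (hκ : 0 < κ) : (stepT κ α c U k).γ * bN P = aNext P κ α := by
  have hN := Ld_pos (P := P)
  have h1 : α * bN P + κ ≠ 0 := by unfold bN; positivity
  show α * (κ / bN P) / (α + κ / bN P) * bN P = α * κ * bN P / (α * bN P + κ)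
  unfold bN at *
  field_simp

/-- dictionary: `H + γP_{k+1} = realify (nOp a′ c U (k+1) univ)` — the argument of `G_{k+1}(u)` ([7] (2.20) one level up) at the constant `a′`.
[cite: Balaban1982Higgs1, (2.20) p.610] -/
theorem stepT_next_arg (hα : 0 < α) (hκ : 0 < κ) :
    (stepT κ α c U k).H + (stepT κ α c U k).γ • (stepT κ α c U k).Pk1 = realify (nOp (aNext P κ α) c U (k + 1) univ) := by
  rw [StepData.Pk1, stepT_Qk1, stepT_Qk1s, Matrix.smul_mul, smul_smul, stepT_γ_mul_bN hα hκ]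
  show realify₂ (lapU c U) + aNext P κ α • (realify₂ (qMatT U (k + 1))ᴴ * realify₂ (qMatT U (k + 1))) = _
  rw [← realify₂_mul, ← realify₂_smul, ← realify₂_add, nOp_univ_eq_lapU, realify₂_eq_realify]

/-- kernel: `a′ > 0`. [cite: Balaban1982Higgs1, (2.13) p.609] -/
theorem aNext_pos (hα : 0 < α) (hκ : 0 < κ) : 0 < aNext P κ α := by
  have hN := Ld_pos (P := P)
  unfold aNext bN at *
  positivity

/-- **[7]'s EUCLIDEAN STRUCTURE (1.5) HOLDS for the realified torus data** (`B1RG242.StepData.ScalarProducts` with weights `1`, `1`, `N·1`):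
positivity, `⟨φ, −Δ_uφ⟩ = Σ_b‖(D_uφ)(b)‖² ≥ 0` (gen 34's `form_lapU`), `Q_kᴴ` resp. `N·Qᴴ` ARE the adjoints of `Q_k` resp. `Q` for these weights
(the realification turns conjugate transposes into transposes, `realify₂_conjTranspose`), `α, β > 0`. [cite: Balaban1982Higgs1, (1.5) p.604] -/
theorem stepT_scalarProducts (hα : 0 < α) (hκ : 0 < κ) :
    (stepT κ α c U k).ScalarProducts 1 1 (bN P • (1 : Matrix _ _ ℝ)) where
  posK u hu := by
    rw [one_mulVec]
    have := (dotProduct_star_self_pos_iff (v := u)).2 hu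
    rwa [star_trivial] at this
  posM v hv := by
    rw [smul_mulVec, one_mulVec, dotProduct_smul, smul_eq_mul]
    have := (dotProduct_star_self_pos_iff (v := v)).2 hv
    rw [star_trivial] at this
    exact mul_pos Ld_pos this
  formH φ := by
    rw [one_mulVec]
    show 0 ≤ φ ⬝ᵥ (realify₂ (lapU c U) *ᵥ φ)
    rw [dotProduct_realify₂_mulVec, form_lapU, Complex.ofReal_re]
    positivity
  adjk φ ψ := by
    rw [one_mulVec, one_mulVec]
    show φ ⬝ᵥ (realify₂ (qMatT U k)ᴴ *ᵥ ψ) = (realify₂ (qMatT U k) *ᵥ φ) ⬝ᵥ ψ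
    rw [realify₂_conjTranspose, dotProduct_mulVec, vecMul_transpose]
  adj ψ θ := by
    rw [one_mulVec, smul_mulVec, one_mulVec]
    show ψ ⬝ᵥ ((bN P • realify₂ (qMatT (lineIter U k) 1)ᴴ) *ᵥ θ) = (realify₂ (qMatT (lineIter U k) 1) *ᵥ ψ) ⬝ᵥ (bN P • θ)
    rw [smul_mulVec, dotProduct_smul, dotProduct_smul, realify₂_conjTranspose, dotProduct_mulVec, vecMul_transpose]
  α_pos := hα
  β_pos := div_pos hκ Ld_pos

/-- **`G_{k+1}(u)` EXISTS**: `H + γP_{k+1} = realify (−Δ_u + a′Q_{k+1}(u)ᴴQ_{k+1}(u))` is invertible (standing range one level up).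
[cite: Balaban1982Higgs1, (2.20) p.610] -/
theorem stepT_isUnit_next (hk : j + k + 1 ≤ P.m + P.K) (hc : c ≠ 0) (hα : 0 < α) (hκ : 0 < κ) :
    IsUnit ((stepT κ α c U k).H + (stepT κ α c U k).γ • (stepT κ α c U k).Pk1) := by
  rw [stepT_next_arg hα hκ]
  exact isUnit_realify (isUnit_nOp_univ (k := k + 1) hk hc (aNext_pos hα hκ) U)

/-- **"IT IS SO" ([7] p. 611) FOR THE U(1)-COVARIANT TORUS OPERATORS**: the argument `κQ(u^{(k)})ᴴQ(u^{(k)}) + Δ_k(T,u)` of `C^{(k)}(u)` (2.31) is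
invertible on `ℓ²(T^{(j+k)})` for every `U(1)` field `u`, `α, κ > 0`, `c ≠ 0` — `B1RG242.StepData.isUnit_C_of_next` (invertibility propagates down
the step) at the realified data, pulled back to the complex matrix. [cite: Balaban1982Higgs1, (2.31) p.611] -/
theorem isUnit_cArgT (hk : j + k + 1 ≤ P.m + P.K) (hc : c ≠ 0) (hα : 0 < α) (hκ : 0 < κ) : IsUnit (cArgT κ α c U k) := by
  have hk' : j + k ≤ P.m + P.K := by omega
  have h := B1RG242.StepData.isUnit_C_of_next (stepT_scalarProducts (c := c) (U := U) (k := k) hα hκ) (stepT_isUnit_next hk hc hα hκ)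
  rw [stepT_C_arg hk' hc hα] at h
  exact isUnit_of_isUnit_realify h

/-- dictionary: `C^{(k)} = realify C^{(k)}(u)` (`cT = cArgT⁻¹`). [cite: Balaban1982Higgs1, (2.31) p.611] -/
theorem stepT_Ck (hk : j + k + 1 ≤ P.m + P.K) (hc : c ≠ 0) (hα : 0 < α) (hκ : 0 < κ) :
    (stepT κ α c U k).Ck = realify (cT κ α c U k) := by
  have hk' : j + k ≤ P.m + P.K := by omega
  rw [StepData.Ck, stepT_C_arg hk' hc hα, realify_inv (isUnit_cArgT hk hc hα hκ), cT]

/-- dictionary: `G_{k+1} = realify (nOp a′ c U (k+1) univ)⁻¹ = realify G_{k+1}(T,u)`. [cite: Balaban1982Higgs1, (2.20) p.610] -/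
theorem stepT_Gk1 (hk : j + k + 1 ≤ P.m + P.K) (hc : c ≠ 0) (hα : 0 < α) (hκ : 0 < κ) :
    (stepT κ α c U k).Gk1 = realify (nOp (aNext P κ α) c U (k + 1) univ)⁻¹ := by
  rw [StepData.Gk1, stepT_next_arg hα hκ, realify_inv (isUnit_nOp_univ (k := k + 1) hk hc (aNext_pos hα hκ) U)]

/-- **THE IDENTITY OF [7] QUOTED ON p. 296, FOR THE U(1)-COVARIANT TORUS OPERATORS OF RECORD AT LEVEL `k`** — *"aL^{−2}I −
a²L^{−4}Q(u_{k+1})C^{(k)}(u_{k+1})Q(u_{k+1})^* = a_kL^{−2}I − a_k²L^{−4}Q_{k+1}(u_{k+1})G^η_{k+1}(u_{k+1})Q_{k+1}(u_{k+1})^*"* (right-hand constant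
read `a_{k+1}`, G-C2-07): as a COMPLEX-MATRIX identity on `ℓ²(T^{(j+k+1)})`,
`κ·1 − κ²·Q(u^{(k)})C^{(k)}(u)Q(u^{(k)})ᴴ = a′·1 − a′²·Q_{k+1}(u)G_{k+1}(T,u)Q_{k+1}(u)ᴴ` with `C^{(k)}(u) = (κQ(u^{(k)})ᴴQ(u^{(k)}) + Δ_k(T,u))^{−1}`,
`G_{k+1}(T,u) = (−Δ_u + a′Q_{k+1}(u)ᴴQ_{k+1}(u))^{−1}`, `a′ = aNext` — `B1RG242.StepData.display221_succ` (the Schur-complement law) at `stepT`, EVERY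
hypothesis discharged (`stepT_QQs`, `stepT_scalarProducts`, `stepT_isUnit_next`, `isUnit_C_of_next`), rescaled by `N` and pulled back along the
injective realification. [cite: BalabanImbrieJaffe1988, (5.8.3) p.296] -/
theorem ident_torus (hk : j + k + 1 ≤ P.m + P.K) (hc : c ≠ 0) (hα : 0 < α) (hκ : 0 < κ) :
    (κ : ℂ) • (1 : Matrix _ _ ℂ) - ((κ ^ 2 : ℝ) : ℂ) • (qMatT (lineIter U k) 1 * cT κ α c U k * (qMatT (lineIter U k) 1)ᴴ) =
      (aNext P κ α : ℂ) • (1 : Matrix _ _ ℂ) -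
        ((aNext P κ α ^ 2 : ℝ) : ℂ) • (qMatT U (k + 1) * (nOp (aNext P κ α) c U (k + 1) univ)⁻¹ * (qMatT U (k + 1))ᴴ) := by
  have hk' : j + k ≤ P.m + P.K := by omega
  set S := stepT κ α c U k with hS
  have E := stepT_scalarProducts (c := c) (U := U) (k := k) hα hκ
  have hnext := stepT_isUnit_next (c := c) (U := U) (k := k) hk hc hα hκ
  have h := S.display221_succ (stepT_QQs hk) E.αβ_ne (B1RG242.StepData.isUnit_prev_of_next E hnext)
    (B1RG242.StepData.isUnit_C_of_next E hnext)
  rw [stepT_Ck hk hc hα hκ, stepT_Gk1 hk hc hα hκ, stepT_Qk1, stepT_Qk1s] at h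
  have hβ : S.β = κ / bN P := rfl
  have hQ : S.Q = realify₂ (qMatT (lineIter U k) 1) := rfl
  have hQs : S.Qs = bN P • realify₂ (qMatT (lineIter U k) 1)ᴴ := rfl
  rw [hβ, hQ, hQs] at h
  -- multiply the realified identity by `N`
  have h2 := congrArg (fun X : Matrix _ _ ℝ => bN P • X) h
  have hN := bN_ne_zero (P := P)
  have hγ := stepT_γ_mul_bN (c := c) (U := U) (k := k) hα hκ
  rw [← hS] at hγ
  have lhs : bN P • ((κ / bN P) • (1 : Matrix _ _ ℝ) - (κ / bN P) ^ 2 •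
        (realify₂ (qMatT (lineIter U k) 1) * realify (cT κ α c U k) * (bN P • realify₂ (qMatT (lineIter U k) 1)ᴴ))) =
      realify₂ ((κ : ℂ) • (1 : Matrix _ _ ℂ) - ((κ ^ 2 : ℝ) : ℂ) • (qMatT (lineIter U k) 1 * cT κ α c U k * (qMatT (lineIter U k) 1)ᴴ)) := by
    rw [realify₂_sub, realify₂_smul, realify₂_smul, realify₂_one, realify₂_mul, realify₂_mul, realify₂_eq_realify (cT κ α c U k),
      smul_sub, smul_smul, mul_div_cancel₀ _ hN, Matrix.mul_smul, smul_smul, smul_smul]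
    congr 2
    field_simp
  have rhs : bN P • (S.γ • (1 : Matrix _ _ ℝ) - S.γ ^ 2 •
        (realify₂ (qMatT U (k + 1)) * realify (nOp (aNext P κ α) c U (k + 1) univ)⁻¹ * (bN P • realify₂ (qMatT U (k + 1))ᴴ))) =
      realify₂ ((aNext P κ α : ℂ) • (1 : Matrix _ _ ℂ) -
        ((aNext P κ α ^ 2 : ℝ) : ℂ) • (qMatT U (k + 1) * (nOp (aNext P κ α) c U (k + 1) univ)⁻¹ * (qMatT U (k + 1))ᴴ)) := by
    rw [realify₂_sub, realify₂_smul, realify₂_smul, realify₂_one, realify₂_mul, realify₂_mul,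
      realify₂_eq_realify ((nOp (aNext P κ α) c U (k + 1) univ)⁻¹), smul_sub, smul_smul, Matrix.mul_smul, smul_smul, smul_smul, ← hγ]
    congr 2
    · ring
    · ring
  exact realify₂_injective (lhs.symm.trans (h2.trans rhs))


/-- **[7] (2.42) FOR THE U(1)-COVARIANT TORUS OPERATORS AT LEVEL `k`** — *"G^ε_{k+1}(Ω,A) = a_k²(L^kε)^{−4}G^ε_kQ^*_kC^{(k),L^kε}Q_kG^ε_k + G^ε_k
(2.42)"*, Ω = the whole torus, in the tree's normalization: `G_{k+1}(T,u) = α²·G_k(T,u)Q_k(u)ᴴC^{(k)}(u)Q_k(u)G_k(T,u) + G_k(T,u)` with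
`G_k(T,u) = (nOp α c U k univ)⁻¹`, `G_{k+1}(T,u) = (nOp a′ c U (k+1) univ)⁻¹` — `B1RG242.StepData.display242` at `stepT`, hypotheses discharged
(the C1-carrier version is p11's `BIJ85PropagatorRG242.rg242_phys`). [cite: Balaban1982Higgs1, (2.42) p.612] -/
theorem rg242_torus (hk : j + k + 1 ≤ P.m + P.K) (hc : c ≠ 0) (hα : 0 < α) (hκ : 0 < κ) :
    (nOp (aNext P κ α) c U (k + 1) univ)⁻¹ =
      ((α ^ 2 : ℝ) : ℂ) • ((nOp α c U k univ)⁻¹ * (qMatT U k)ᴴ * cT κ α c U k * qMatT U k * (nOp α c U k univ)⁻¹) +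
        (nOp α c U k univ)⁻¹ := by
  have hk' : j + k ≤ P.m + P.K := by omega
  have E := stepT_scalarProducts (c := c) (U := U) (k := k) hα hκ
  have hnext := stepT_isUnit_next (c := c) (U := U) (k := k) hk hc hα hκ
  have h := (stepT κ α c U k).display242_of_next E (stepT_QQs hk) hnext
  rw [stepT_Gk1 hk hc hα hκ, stepT_Gk hk' hc hα, stepT_Ck hk hc hα hκ] at h
  have hQk : (stepT κ α c U k).Qk = realify₂ (qMatT U k) := rfl
  have hQks : (stepT κ α c U k).Qks = realify₂ (qMatT U k)ᴴ := rfl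
  have hα' : (stepT κ α c U k).α = α := rfl
  rw [hQk, hQks, hα', ← realify₂_eq_realify, ← realify₂_eq_realify, ← realify₂_eq_realify, ← realify₂_mul, ← realify₂_mul, ← realify₂_mul,
    ← realify₂_mul, ← realify₂_smul, ← realify₂_add] at h
  exact realify₂_injective h

/-- **[7] (2.41) FOR THE U(1)-COVARIANT TORUS OPERATORS AT LEVEL `k`** — *"Q_{k+1}(A)G^ε_{k+1}(Ω,A) = (aa_k/a_{k+1})(L^kε)^{−2}Q(A)C^{(k),L^kε}Q_k(A)G^ε_k
(2.41)"*: `Q_{k+1}(u)G_{k+1}(T,u) = (α + κ/N)·Q(u^{(k)})C^{(k)}(u)Q_k(u)G_k(T,u)` (`α + β` for the printed `(aa_k/a_{k+1})(L^kε)^{−2}`) —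
`B1RG242.StepData.display241` at `stepT`. [cite: Balaban1982Higgs1, (2.41) p.612] -/
theorem rg241_torus (hk : j + k + 1 ≤ P.m + P.K) (hc : c ≠ 0) (hα : 0 < α) (hκ : 0 < κ) :
    qMatT U (k + 1) * (nOp (aNext P κ α) c U (k + 1) univ)⁻¹ =
      ((α + κ / bN P : ℝ) : ℂ) • (qMatT (lineIter U k) 1 * cT κ α c U k * qMatT U k * (nOp α c U k univ)⁻¹) := by
  have hk' : j + k ≤ P.m + P.K := by omega
  have E := stepT_scalarProducts (c := c) (U := U) (k := k) hα hκ
  have hnext := stepT_isUnit_next (c := c) (U := U) (k := k) hk hc hα hκ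
  have h := (stepT κ α c U k).display241_of_next E (stepT_QQs hk) hnext
  rw [stepT_Gk1 hk hc hα hκ, stepT_Gk hk' hc hα, stepT_Ck hk hc hα hκ, stepT_Qk1] at h
  have hQk : (stepT κ α c U k).Qk = realify₂ (qMatT U k) := rfl
  have hQ : (stepT κ α c U k).Q = realify₂ (qMatT (lineIter U k) 1) := rfl
  have hα' : (stepT κ α c U k).α = α := rfl
  have hβ' : (stepT κ α c U k).β = κ / bN P := rfl
  rw [hQk, hQ, hα', hβ', ← realify₂_eq_realify, ← realify₂_eq_realify, ← realify₂_eq_realify, ← realify₂_mul, ← realify₂_mul, ← realify₂_mul,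
    ← realify₂_mul, ← realify₂_smul] at h
  exact realify₂_injective h

end Step


/-! ## §3  The §5.8 dictionary `Ops` at step `k` on the torus, and its laws -/

section Dictionary583

variable {ι : Type*} [Fintype ι]
variable (k : ℕ) (Λ Λ₇ Λ₈ : Finset (Balaban1983to89.Site P (j + k))) (Λ₈' : Finset (Balaban1983to89.Site P (j + k + 1))) (κ α c : ℝ)
  (U : GaugeField P j U1) (Δ : Matrix (Balaban1983to89.Site P (j + k)) (Balaban1983to89.Site P (j + k)) ℂ) (M : ℕ) (ρ : ℝ)
  (cube : ι → Finset (Balaban1983to89.Site P j)) (lam : ι → Balaban1983to89.Site P j → Balaban1983to89.Site P j → ℝ)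
  (ζ'' : Balaban1983to89.Site P j → Balaban1983to89.Site P j → ℝ)

/-- **THE §5.8 OPERATOR DICTIONARY AT STEP `k` ON THE REALIFIED TORUS CARRIERS** (pp. 295–296): unit lattice `M = E T^{(j+k)}` (`φ`), block
lattice `N = E T^{(j+k+1)}` (`ψ`), fine `η`-lattice `F = E T^{(j)}` (where `G^η_{k+1}` acts); `a = κ` (the printed `aL^{−2}`), `ak = a′` (G-C2-07:
`a_{k+1}`); `Λ8 = RL 1_{Λ₈}` (`Λ₈^{(k−1)′}`, a union of blocks), `Δ = RL Δ` (the kernel of `Δ_{k,loc}(ũ_{k+1})` — the slot takes ANY Hermitian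
unit-lattice kernel; of record: p31's `deltaLocT α c ũ k …`, see `opsK_laws_deltaLocT`), `P = RL P(u^{(k)})` (p31's `pOp`), `Λ7 = RL 1_{Λ₇}`,
`C = RL C^{(k)}(u)` (`cT`), `Cloc = RL C^{(k)}_{Λ,loc}` (gen 34's (2.43) kernel `cLocC` of the (2.40) operator `Δ + κP(u^{(k)})`), `Q = RL Q(u^{(k)})`,
`Qst = RL Q(u^{(k)})ᴴ`, `Tst` = the adjoint of the (5.8.1) shift, `Λ8' = RL 1_{Λ₈′}`, `Q1 = RL Q_{k+1}(u)`, `Q1st = RL Q_{k+1}(u)ᴴ`,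
`G = RL G_{k+1}(T,u)` (`(nOp a′ c U (k+1) univ)⁻¹`), `Gloc = RL G_{k+1,loc}(u)` (p31's (2.28) `gLocT a′ c U (k+1) cube lam ζ″`).
[cite: BalabanImbrieJaffe1988, (5.8.3) p.296] -/
def opsK : Ops (E (Balaban1983to89.Site P (j + k))) (E (Balaban1983to89.Site P (j + k + 1))) (E (Balaban1983to89.Site P j)) where
  a := κ
  ak := aNext P κ α
  Λ8 := RL (proj Λ₈)
  Δ := RL Δ
  P := RL (pOp (lineIter U k))
  Λ7 := RL (proj Λ₇)
  C := RL (cT κ α c U k)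
  Cloc := RL (cLocC Λ (op240 Δ κ (lineIter U k)) M ρ)
  Q := RL (qMatT (lineIter U k) 1)
  Qst := RL (qMatT (lineIter U k) 1)ᴴ
  Tst := κ • RL (proj Λ₇ * cLocC Λ (op240 Δ κ (lineIter U k)) M ρ * (qMatT (lineIter U k) 1)ᴴ)ᴴ
  Λ8' := RL (proj Λ₈')
  Q1 := RL (qMatT U (k + 1))
  Q1st := RL (qMatT U (k + 1))ᴴ
  G := RL (nOp (aNext P κ α) c U (k + 1) univ)⁻¹
  Gloc := RL (gLocT (aNext P κ α) c U (k + 1) cube lam ζ'')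

/-- **the (5.8.1) shift at the instance is ONE realified kernel**: p02's `Ops.T = a•(Λ7 ∘ Cloc ∘ Qst)` is `κ·RL(1_{Λ₇}·C^{(k)}_{Λ,loc}·Q(u^{(k)})ᴴ)`.
[cite: BalabanImbrieJaffe1988, (5.8.1) p.295] -/
theorem T_eq : (opsK k Λ Λ₇ Λ₈ Λ₈' κ α c U Δ M ρ cube lam ζ'').T =
    κ • RL (proj Λ₇ * cLocC Λ (op240 Δ κ (lineIter U k)) M ρ * (qMatT (lineIter U k) 1)ᴴ) := by
  rw [RL_mul, RL_mul]
  rfl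

/-- kernel: the shift in complex coordinates: `φ_{Tψ} = κ·(1_{Λ₇}·C^{(k)}_{Λ,loc}·Q(u^{(k)})ᴴ)ψ`. [cite: BalabanImbrieJaffe1988, (5.8.1) p.295] -/
theorem cplx_T_apply (Ψ : E (Balaban1983to89.Site P (j + k + 1))) :
    cplx (WithLp.ofLp ((opsK k Λ Λ₇ Λ₈ Λ₈' κ α c U Δ M ρ cube lam ζ'').T Ψ)) =
      (κ : ℂ) • ((proj Λ₇ * cLocC Λ (op240 Δ κ (lineIter U k)) M ρ * (qMatT (lineIter U k) 1)ᴴ) *ᵥ cplx (WithLp.ofLp Ψ)) := by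
  rw [T_eq, LinearMap.smul_apply, WithLp.ofLp_smul, cplx_smul, cplx_ofLp_RL]

/-- **(5.8.1) ON THE TORUS** — *"φ = φ^{(k)} + aL^{−2}Λ₇^{(k)}C^{(k)}_{loc}(u_{k+1})Q^*(u_{k+1})ψ. (5.8.1)"* as a complex field on `T^{(j+k)}`:
`φ^{(k)} + κ·1_{Λ₇}C^{(k)}_{Λ,loc}Q(u^{(k)})ᴴψ`. [cite: BalabanImbrieJaffe1988, (5.8.1) p.295] -/
def transl581T (φk : Balaban1983to89.Site P (j + k) → ℂ) (ψ : Balaban1983to89.Site P (j + k + 1) → ℂ) : Balaban1983to89.Site P (j + k) → ℂ :=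
  φk + (κ : ℂ) • ((proj Λ₇ * cLocC Λ (op240 Δ κ (lineIter U k)) M ρ * (qMatT (lineIter U k) 1)ᴴ) *ᵥ ψ)

/-- kernel: `φ^{(k)} + Tψ` in complex coordinates IS `transl581T`. [cite: BalabanImbrieJaffe1988, (5.8.1) p.295] -/
theorem cplx_transl_eq (Φk : E (Balaban1983to89.Site P (j + k))) (Ψ : E (Balaban1983to89.Site P (j + k + 1))) :
    cplx (WithLp.ofLp (Φk + (opsK k Λ Λ₇ Λ₈ Λ₈' κ α c U Δ M ρ cube lam ζ'').T Ψ)) =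
      transl581T k Λ Λ₇ κ U Δ M ρ (cplx (WithLp.ofLp Φk)) (cplx (WithLp.ofLp Ψ)) := by
  rw [WithLp.ofLp_add, cplx_add, cplx_T_apply, transl581T]

/-- kernel: a real multiple of a complex field is the multiple by the real number read in `ℂ`. [cite: BalabanImbrieJaffe1988, (5.8.1) p.295] -/
private theorem real_smul_eq_coe_smul {n : Type*} (r : ℝ) (v : n → ℂ) : r • v = (r : ℂ) • v := by
  funext x
  rw [Pi.smul_apply, Pi.smul_apply, smul_eq_mul, Complex.real_smul]

/-- **(5.8.1) ON THE TORUS IS r16's TYPED `transl581`** (the translation over real-linear maps, `BIJ88Sect5StatementsPart4`) at the torus kernels read as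
real-linear maps, with `κ = aL^{−2}`. [cite: BalabanImbrieJaffe1988, (5.8.1) p.295] -/
theorem transl581T_eq_transl581 (a L : ℝ) (φk : Balaban1983to89.Site P (j + k) → ℂ) (ψ : Balaban1983to89.Site P (j + k + 1) → ℂ) :
    transl581T k Λ Λ₇ (a * L⁻¹ ^ 2) U Δ M ρ φk ψ =
      transl581 a L ((proj Λ₇).mulVecLin.restrictScalars ℝ)
        ((cLocC Λ (op240 Δ (a * L⁻¹ ^ 2) (lineIter U k)) M ρ).mulVecLin.restrictScalars ℝ)
        (((qMatT (lineIter U k) 1)ᴴ).mulVecLin.restrictScalars ℝ) φk ψ := by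
  rewrite [transl581, transl581T, LinearMap.restrictScalars_apply, LinearMap.restrictScalars_apply, LinearMap.restrictScalars_apply,
    Matrix.mulVecLin_apply, Matrix.mulVecLin_apply, Matrix.mulVecLin_apply, mulVec_mulVec, mulVec_mulVec, real_smul_eq_coe_smul]
  rfl

/-- **p02's `Δ^L_{k+1,loc} = ak•I − ak²•(Q1 ∘ Gloc ∘ Q1st)` at the instance IS p31's (2.34) ONE LEVEL UP**: `RL (deltaLocT a′ c U (k+1) cube lam ζ″)`
= `RL (a′·1 − a′²·Q_{k+1}(u)G_{k+1,loc}(u)Q_{k+1}(u)ᴴ)` — *"This yields the desired form Δ^L_{k+1,loc}(u_{k+1})"* (p. 296).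
[cite: BalabanImbrieJaffe1988, (2.34) p.263] -/
theorem deltaLloc_eq_RL_deltaLocT :
    (opsK k Λ Λ₇ Λ₈ Λ₈' κ α c U Δ M ρ cube lam ζ'').deltaLloc = RL (deltaLocT (aNext P κ α) c U (k + 1) cube lam ζ'') := by
  have hsq : ((aNext P κ α : ℂ) ^ 2) = ((aNext P κ α ^ 2 : ℝ) : ℂ) := by push_cast; ring
  rw [deltaLocT, hsq, RL_sub, RL_smul, RL_smul, RL_one, RL_mul, RL_mul]
  rfl

variable {k Λ Λ₇ Λ₈ Λ₈' κ α c U Δ M ρ cube lam ζ''}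

/-- **THE EUCLIDEAN LAWS OF THE DICTIONARY HOLD AT STEP `k`** (`Ops.Laws`): `Δ` symmetric for a Hermitian kernel, `Λ₈ = RL 1_{Λ₈}` a symmetric
idempotent COMMUTING WITH `P(u^{(k)})` when `Λ₈` is a union of blocks (`proj_mul_pOp_comm` — the reading accepted for (5.8.2)), `⟨Qx, Qy⟩ = ⟨x, Py⟩`,
the adjoint pairs `(Q, Q*)`, `(T, T*)`, `Λ₈′` symmetric, and **the identity of [7] (`Laws.ident`) = `ident_torus`** read through `RL`.
[cite: BalabanImbrieJaffe1988, (5.8.3) p.296] -/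
theorem opsK_laws (hk : j + k + 1 ≤ P.m + P.K) (hc : c ≠ 0) (hα : 0 < α) (hκ : 0 < κ) (hΔ : Δᴴ = Δ) (hΛ₈ : IsBlockUnion 1 Λ₈) :
    (opsK k Λ Λ₇ Λ₈ Λ₈' κ α c U Δ M ρ cube lam ζ'').Laws where
  Δsym x y := by
    show ⟪RL Δ x, y⟫ = ⟪x, RL Δ y⟫
    rw [inner_RL_left, hΔ]
  Λ8sym x y := by
    show ⟪RL (proj Λ₈) x, y⟫ = ⟪x, RL (proj Λ₈) y⟫
    rw [inner_RL_left, proj_conjTranspose]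
  Λ8idem x := by
    show RL (proj Λ₈) (RL (proj Λ₈) x) = RL (proj Λ₈) x
    rw [← LinearMap.comp_apply, ← RL_mul, proj_mul_proj]
  Λ8P x := by
    show RL (proj Λ₈) (RL (pOp (lineIter U k)) x) = RL (pOp (lineIter U k)) (RL (proj Λ₈) x)
    rw [← LinearMap.comp_apply, ← RL_mul, proj_mul_pOp_comm (lineIter U k) hΛ₈, RL_mul, LinearMap.comp_apply]
  Padj x y := by
    show ⟪RL (qMatT (lineIter U k) 1) x, RL (qMatT (lineIter U k) 1) y⟫ = ⟪x, RL (pOp (lineIter U k)) y⟫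
    rw [inner_RL_left, ← LinearMap.comp_apply, ← RL_mul]
    rfl
  Qadj x y := by
    show ⟪RL (qMatT (lineIter U k) 1) x, y⟫ = ⟪x, RL (qMatT (lineIter U k) 1)ᴴ y⟫
    exact inner_RL_left _ _ _
  Tadj y x := by
    show ⟪(opsK k Λ Λ₇ Λ₈ Λ₈' κ α c U Δ M ρ cube lam ζ'').T y, x⟫ =
      ⟪y, (κ • RL (proj Λ₇ * cLocC Λ (op240 Δ κ (lineIter U k)) M ρ * (qMatT (lineIter U k) 1)ᴴ)ᴴ) x⟫
    rw [T_eq, LinearMap.smul_apply, LinearMap.smul_apply, real_inner_smul_left, real_inner_smul_right, inner_RL_left]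
  Λ8'sym u v := by
    show ⟪RL (proj Λ₈') u, v⟫ = ⟪u, RL (proj Λ₈') v⟫
    rw [inner_RL_left, proj_conjTranspose]
  ident := by
    have h := congrArg (fun A => RL A) (ident_torus (c := c) (U := U) (k := k) hk hc hα hκ)
    rw [Matrix.mul_assoc, Matrix.mul_assoc, RL_sub, RL_smul, RL_smul, RL_one, RL_mul, RL_mul, RL_sub, RL_smul, RL_smul, RL_one,
      RL_mul, RL_mul] at h
    exact h

/-- **THE `Δ`-SLOT OF RECORD**: with `Δ = Δ_{k,loc}(ũ_{k+1})` = p31's (2.34) `deltaLocT α c ũ k cube₀ lam₀ ζ₀″` at ANY `U(1)` field `ũ` (Hermitian by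
p31's `deltaLocT_conjTranspose`: cubes unions of `k`-blocks, symmetric weights and cut-off) the laws hold. [cite: BalabanImbrieJaffe1988, (5.8.1) p.295] -/
theorem opsK_laws_deltaLocT (hk : j + k + 1 ≤ P.m + P.K) (hc : c ≠ 0) (hα : 0 < α) (hκ : 0 < κ) (hΛ₈ : IsBlockUnion 1 Λ₈)
    (Ut : GaugeField P j U1) {ι₀ : Type*} [Fintype ι₀] {cube₀ : ι₀ → Finset (Balaban1983to89.Site P j)} (hcube : ∀ a, IsBlockUnion k (cube₀ a))
    {lam₀ : ι₀ → Balaban1983to89.Site P j → Balaban1983to89.Site P j → ℝ} (hlam : ∀ a x₁ x₂, lam₀ a x₂ x₁ = lam₀ a x₁ x₂)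
    {ζ₀ : Balaban1983to89.Site P j → Balaban1983to89.Site P j → ℝ} (hζ : ∀ x₁ x₂, ζ₀ x₂ x₁ = ζ₀ x₁ x₂) :
    (opsK k Λ Λ₇ Λ₈ Λ₈' κ α c U (deltaLocT α c Ut k cube₀ lam₀ ζ₀) M ρ cube lam ζ'').Laws :=
  opsK_laws hk hc hα hκ (deltaLocT_conjTranspose (by omega) hc hα Ut hcube hlam hζ) hΛ₈

end Dictionary583

/-! ## §4  (5.8.3) on the torus at step `k`, in complex coordinates -/

section Main583

variable {ι : Type*} [Fintype ι]
variable (k : ℕ) (Λ Λ₇ Λ₈ : Finset (Balaban1983to89.Site P (j + k))) (Λ₈' : Finset (Balaban1983to89.Site P (j + k + 1))) (κ α c : ℝ)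
  (U : GaugeField P j U1) (Δ : Matrix (Balaban1983to89.Site P (j + k)) (Balaban1983to89.Site P (j + k)) ℂ) (M : ℕ) (ρ : ℝ)
  (cube : ι → Finset (Balaban1983to89.Site P j)) (lam : ι → Balaban1983to89.Site P j → Balaban1983to89.Site P j → ℝ)
  (ζ'' : Balaban1983to89.Site P j → Balaban1983to89.Site P j → ℝ)

/-- **THE COLLECTED TERMS OF (5.8.3) MADE EXPLICIT** — *"𝒬₄ + 𝒬₅ + 𝒬₆ + … + ⟨φ^{(k)}, w₆ψ⟩ + ½⟨ψ, w₇ψ⟩ … with w₆, w₇ small local kernels, and with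
𝒬₄, 𝒬₅, 𝒬₆ localized near Λ₈^{(k)′c}"*: the real number `𝒬₄ + 𝒬₅ + 𝒬₆ + ⟨φ^{(k)}, w₆ψ⟩ + ½⟨ψ, w₇ψ⟩` of p02's `BIJ88ScalarTransl582.Q4` /
`BIJ88ScalarSummary583.Ops.Q5/Q6/w6/w7` EVALUATED AT THE TORUS DICTIONARY `opsK`; sizes and ranges are NOT claimed.
[cite: BalabanImbrieJaffe1988, (5.8.3) p.296] -/
def negl583 (φk : Balaban1983to89.Site P (j + k) → ℂ) (ψ : Balaban1983to89.Site P (j + k + 1) → ℂ) : ℝ :=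
  BIJ88ScalarTransl582.Q4 κ (opsK k Λ Λ₇ Λ₈ Λ₈' κ α c U Δ M ρ cube lam ζ'').Λ8 (opsK k Λ Λ₇ Λ₈ Λ₈' κ α c U Δ M ρ cube lam ζ'').P (toE φk)
    + (opsK k Λ Λ₇ Λ₈ Λ₈' κ α c U Δ M ρ cube lam ζ'').Q5 (toE φk) (toE ψ) + (opsK k Λ Λ₇ Λ₈ Λ₈' κ α c U Δ M ρ cube lam ζ'').Q6 (toE ψ)
    + ⟪toE φk, (opsK k Λ Λ₇ Λ₈ Λ₈' κ α c U Δ M ρ cube lam ζ'').w6 (toE ψ)⟫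
    + (1 / 2) * ⟪toE ψ, (opsK k Λ Λ₇ Λ₈ Λ₈' κ α c U Δ M ρ cube lam ζ'').w7 (toE ψ)⟫

/-- kernel: the coordinates of `RL (proj Λ) x` are the restriction `1_Λφ_x`. [cite: BalabanImbrieJaffe1988, (5.8.3) p.296] -/
theorem cplx_ofLp_RL_proj {n : ℕ} (S : Finset (Balaban1983to89.Site P n)) (x : E (Balaban1983to89.Site P n)) :
    cplx (WithLp.ofLp (RL (proj S) x)) = proj S *ᵥ cplx (WithLp.ofLp x) := cplx_ofLp_RL _ _

/-- kernel: the left side of p02's `eq583` at the instance, in complex coordinates: `½ Re (1_{Λ₈}φ)ᴴΔ(1_{Λ₈}φ) + ½κ Σ_y‖ψ(y) − (Q(u^{(k)})φ)(y)‖²` at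
`φ = cplx(Φk + TΨ)`, `ψ = cplx Ψ` (the two forms of p. 295 *"½⟨Λ₈^{(k−1)′}φ, Δ_{k,loc}(ũ_{k+1})Λ₈^{(k−1)′}φ⟩ + ½aL^{−2}⟨ψ − Q(ũ_{k+1})φ, ψ − Q(ũ_{k+1})φ⟩"*,
the one-step average `Q(u^{(k)})` = r18's (2.6) `qCov` at p11's line field). [cite: BalabanImbrieJaffe1988, (5.8.1) p.295] -/
theorem scalarForms_opsK_eq (Φ : E (Balaban1983to89.Site P (j + k))) (Ψ : E (Balaban1983to89.Site P (j + k + 1))) :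
    BIJ88ScalarTransl582.scalarForms κ (opsK k Λ Λ₇ Λ₈ Λ₈' κ α c U Δ M ρ cube lam ζ'').Λ8 (opsK k Λ Λ₇ Λ₈ Λ₈' κ α c U Δ M ρ cube lam ζ'').Δ
        (opsK k Λ Λ₇ Λ₈ Λ₈' κ α c U Δ M ρ cube lam ζ'').Q Φ Ψ =
      (1 / 2) * (star (proj Λ₈ *ᵥ cplx (WithLp.ofLp Φ)) ⬝ᵥ (Δ *ᵥ (proj Λ₈ *ᵥ cplx (WithLp.ofLp Φ)))).re +
        (1 / 2) * κ * ∑ y, ‖cplx (WithLp.ofLp Ψ) y - qCov (lineIter U k) (cplx (WithLp.ofLp Φ)) y‖ ^ 2 := by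
  show (1 / 2) * ⟪RL (proj Λ₈) Φ, RL Δ (RL (proj Λ₈) Φ)⟫ +
      (1 / 2) * κ * ⟪Ψ - RL (qMatT (lineIter U k) 1) Φ, Ψ - RL (qMatT (lineIter U k) 1) Φ⟫ = _
  rw [inner_RL, cplx_ofLp_RL, inner_self_eq_sum_norm_sq, WithLp.ofLp_sub, cplx_sub, cplx_ofLp_RL]
  congr 2
  refine Finset.sum_congr rfl fun y _ => ?_
  rw [Pi.sub_apply, qMatT_mulVec, qCovK_one]

/-- kernel: the first MAIN form of p02's `eq583` at the instance, in complex coordinates: `½ Re (1_{Λ₈}φ^{(k)})ᴴ(Δ + κP(u^{(k)}))(1_{Λ₈}φ^{(k)})`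
with `Δ + κP(u^{(k)})` = p31's `op240 Δ κ u^{(k)}`. [cite: BalabanImbrieJaffe1988, (5.8.3) p.296] -/
theorem mainFormPhi_opsK_eq (Φk : E (Balaban1983to89.Site P (j + k))) :
    (1 / 2) * ⟪(opsK k Λ Λ₇ Λ₈ Λ₈' κ α c U Δ M ρ cube lam ζ'').Λ8 Φk,
        (opsK k Λ Λ₇ Λ₈ Λ₈' κ α c U Δ M ρ cube lam ζ'').Δ ((opsK k Λ Λ₇ Λ₈ Λ₈' κ α c U Δ M ρ cube lam ζ'').Λ8 Φk) +
          κ • (opsK k Λ Λ₇ Λ₈ Λ₈' κ α c U Δ M ρ cube lam ζ'').P ((opsK k Λ Λ₇ Λ₈ Λ₈' κ α c U Δ M ρ cube lam ζ'').Λ8 Φk)⟫ =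
      (1 / 2) * (star (proj Λ₈ *ᵥ cplx (WithLp.ofLp Φk)) ⬝ᵥ (op240 Δ κ (lineIter U k) *ᵥ (proj Λ₈ *ᵥ cplx (WithLp.ofLp Φk)))).re := by
  show (1 / 2) * ⟪RL (proj Λ₈) Φk, RL Δ (RL (proj Λ₈) Φk) + κ • RL (pOp (lineIter U k)) (RL (proj Λ₈) Φk)⟫ = _
  have hop : RL Δ (RL (proj Λ₈) Φk) + κ • RL (pOp (lineIter U k)) (RL (proj Λ₈) Φk) = RL (op240 Δ κ (lineIter U k)) (RL (proj Λ₈) Φk) := by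
    rw [op240, RL_add, RL_smul, LinearMap.add_apply, LinearMap.smul_apply]
  rw [hop, inner_RL, cplx_ofLp_RL]

/-- kernel: the second MAIN form of p02's `eq583` at the instance, in complex coordinates: `½ Re (1_{Λ₈′}ψ)ᴴΔ^L_{k+1,loc}(u)(1_{Λ₈′}ψ)` with
`Δ^L_{k+1,loc}(u)` = p31's `deltaLocT a′ c U (k+1) …`. [cite: BalabanImbrieJaffe1988, (5.8.3) p.296] -/
theorem mainFormPsi_opsK_eq (Ψ : E (Balaban1983to89.Site P (j + k + 1))) :
    (1 / 2) * ⟪(opsK k Λ Λ₇ Λ₈ Λ₈' κ α c U Δ M ρ cube lam ζ'').Λ8' Ψ,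
        (opsK k Λ Λ₇ Λ₈ Λ₈' κ α c U Δ M ρ cube lam ζ'').deltaLloc ((opsK k Λ Λ₇ Λ₈ Λ₈' κ α c U Δ M ρ cube lam ζ'').Λ8' Ψ)⟫ =
      (1 / 2) * (star (proj Λ₈' *ᵥ cplx (WithLp.ofLp Ψ)) ⬝ᵥ
          (deltaLocT (aNext P κ α) c U (k + 1) cube lam ζ'' *ᵥ (proj Λ₈' *ᵥ cplx (WithLp.ofLp Ψ)))).re := by
  rw [deltaLloc_eq_RL_deltaLocT]
  show (1 / 2) * ⟪RL (proj Λ₈') Ψ, RL (deltaLocT (aNext P κ α) c U (k + 1) cube lam ζ'') (RL (proj Λ₈') Ψ)⟫ = _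
  rw [inner_RL, cplx_ofLp_RL]

/-- **(5.8.3) ON THE TORUS AT STEP `k`, AT THE OBJECTS OF RECORD** (p. 296, verbatim as printed: *"To summarize, we have written ½⟨Λ₈^{(k−1)′}φ,
Δ_{k,loc}(ũ_{k+1})Λ₈^{(k−1)′}φ⟩ + ½aL^{−2}⟨ψ − Q(ũ_{k+1})φ, ψ − Q(ũ_{k+1})φ⟩ = 𝒬₄ + 𝒬₅ + 𝒬₆ + ½⟨Λ₈^{(k−1)′}φ^{(k)}, (Δ_{k,loc}(ũ_{k+1}) +
aL^{−2}P(ũ_{k+1}))Λ₈^{(k−1)′}φ^{(k)}⟩ + ½⟨Λ₈^{(k)″}ψ, Δ^L_{k+1,loc}(u_{k+1})Λ₈^{(k)′}ψ⟩ + ⟨φ^{(k)}, w₆ψ⟩ + ½⟨ψ, w₇ψ⟩, (5.8.3)"* — the left slot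
`Λ₈^{(k)″}ψ` is read `Λ₈^{(k)′}ψ` here, ruling G-C2-13 applied (both slots `proj Λ₈′` below), as in the module header): for every `U(1)`
field `u` on the `η`-lattice, every Hermitian unit-lattice kernel `Δ` (of record: `Δ_{k,loc}(ũ_{k+1})`), every union of blocks `Λ₈` and all fields
`φ^{(k)}`, `ψ`, with the translated field (5.8.1) `φ = transl581T … φ^{(k)} ψ`:
`½ Re (1_{Λ₈}φ)ᴴΔ(1_{Λ₈}φ) + ½κ Σ_y‖ψ(y) − (Q(u^{(k)})φ)(y)‖² = ½ Re (1_{Λ₈}φ^{(k)})ᴴ(Δ + κP(u^{(k)}))(1_{Λ₈}φ^{(k)}) +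
½ Re (1_{Λ₈′}ψ)ᴴ Δ_{k+1,loc}(u)[a′] (1_{Λ₈′}ψ) + negl583` — p02's `Ops.eq583` on the abstract carrier, instantiated by `opsK` / `opsK_laws` (the
identity of [7] inside it being `ident_torus`), `Δ^L_{k+1,loc}(u_{k+1})` = p31's (2.34) at level `k + 1` with the constant `a′`.
[cite: BalabanImbrieJaffe1988, (5.8.3) p.296] -/
theorem eq583_torus (hk : j + k + 1 ≤ P.m + P.K) (hc : c ≠ 0) (hα : 0 < α) (hκ : 0 < κ) (hΔ : Δᴴ = Δ) (hΛ₈ : IsBlockUnion 1 Λ₈)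
    (φk : Balaban1983to89.Site P (j + k) → ℂ) (ψ : Balaban1983to89.Site P (j + k + 1) → ℂ) :
    (1 / 2) * (star (proj Λ₈ *ᵥ transl581T k Λ Λ₇ κ U Δ M ρ φk ψ) ⬝ᵥ (Δ *ᵥ (proj Λ₈ *ᵥ transl581T k Λ Λ₇ κ U Δ M ρ φk ψ))).re +
        (1 / 2) * κ * ∑ y, ‖ψ y - qCov (lineIter U k) (transl581T k Λ Λ₇ κ U Δ M ρ φk ψ) y‖ ^ 2 =
      (1 / 2) * (star (proj Λ₈ *ᵥ φk) ⬝ᵥ (op240 Δ κ (lineIter U k) *ᵥ (proj Λ₈ *ᵥ φk))).re +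
        (1 / 2) * (star (proj Λ₈' *ᵥ ψ) ⬝ᵥ (deltaLocT (aNext P κ α) c U (k + 1) cube lam ζ'' *ᵥ (proj Λ₈' *ᵥ ψ))).re +
        negl583 k Λ Λ₇ Λ₈ Λ₈' κ α c U Δ M ρ cube lam ζ'' φk ψ := by
  have h := (opsK k Λ Λ₇ Λ₈ Λ₈' κ α c U Δ M ρ cube lam ζ'').eq583 (opsK_laws hk hc hα hκ hΔ hΛ₈) (toE φk) (toE ψ)
  have ha : (opsK k Λ Λ₇ Λ₈ Λ₈' κ α c U Δ M ρ cube lam ζ'').a = κ := rfl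
  rw [ha, scalarForms_opsK_eq, cplx_transl_eq, mainFormPhi_opsK_eq, mainFormPsi_opsK_eq, cplx_ofLp_toE, cplx_ofLp_toE] at h
  rw [h, negl583]
  ring

/-- (5.8.3) on the torus for r16's typed translation `transl581` (`κ = aL^{−2}`). [cite: BalabanImbrieJaffe1988, (5.8.3) p.296] -/
theorem eq583_torus_transl581 (a L : ℝ) (hk : j + k + 1 ≤ P.m + P.K) (hc : c ≠ 0) (hα : 0 < α) (hκ : 0 < a * L⁻¹ ^ 2) (hΔ : Δᴴ = Δ)
    (hΛ₈ : IsBlockUnion 1 Λ₈) (φk : Balaban1983to89.Site P (j + k) → ℂ) (ψ : Balaban1983to89.Site P (j + k + 1) → ℂ) :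
    let φ := transl581 a L ((proj Λ₇).mulVecLin.restrictScalars ℝ)
        ((cLocC Λ (op240 Δ (a * L⁻¹ ^ 2) (lineIter U k)) M ρ).mulVecLin.restrictScalars ℝ)
        (((qMatT (lineIter U k) 1)ᴴ).mulVecLin.restrictScalars ℝ) φk ψ
    (1 / 2) * (star (proj Λ₈ *ᵥ φ) ⬝ᵥ (Δ *ᵥ (proj Λ₈ *ᵥ φ))).re +
        (1 / 2) * (a * L⁻¹ ^ 2) * ∑ y, ‖ψ y - qCov (lineIter U k) φ y‖ ^ 2 =
      (1 / 2) * (star (proj Λ₈ *ᵥ φk) ⬝ᵥ (op240 Δ (a * L⁻¹ ^ 2) (lineIter U k) *ᵥ (proj Λ₈ *ᵥ φk))).re +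
        (1 / 2) * (star (proj Λ₈' *ᵥ ψ) ⬝ᵥ
          (deltaLocT (aNext P (a * L⁻¹ ^ 2) α) c U (k + 1) cube lam ζ'' *ᵥ (proj Λ₈' *ᵥ ψ))).re +
        negl583 k Λ Λ₇ Λ₈ Λ₈' (a * L⁻¹ ^ 2) α c U Δ M ρ cube lam ζ'' φk ψ := by
  intro φ
  rw [show φ = transl581T k Λ Λ₇ (a * L⁻¹ ^ 2) U Δ M ρ φk ψ from (transl581T_eq_transl581 k Λ Λ₇ U Δ M ρ a L φk ψ).symm]
  exact eq583_torus k Λ Λ₇ Λ₈ Λ₈' (a * L⁻¹ ^ 2) α c U Δ M ρ cube lam ζ'' hk hc hα hκ hΔ hΛ₈ φk ψ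

end Main583

end

end Literature.MathematicalPhysics.QuantumFieldTheory.BalabanImbrieJaffe1984to88.BIJ88ScalarSummary583OpsTorus
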